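import Mathlib

/-!
Scratch (lens-1 g9): exact typing of NODE v25 rung R1 — two-body foot-chord descent — statement only (elaboration check).
-/

open Complex

noncomputable section

namespace RhW08.Lens1Rung

/-- Two-body toy field: the pair at `a = i`, `ā = −i` (which IS `2z/(1+z²)`) plus one mate pair `m = x + iy`, `m̄`. -/
def phiM (x y : ℝ) (z : ℂ) : ℂ := 2 * z / (1 + z ^ 2) + 1 / (z - ⟨x, y⟩) + 1 / (z - ⟨x, -y⟩)

/-- Circle data of the mate pair on the unit circle (the `a`-pair is real there). -/
def hM (x y θ : ℝ) : ℝ := (1 / (cexp (θ * I) - ⟨x, y⟩) + 1 / (cexp (θ * I) - ⟨x, -y⟩)).im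

/-- RUNG R1 — TWO-BODY FOOT-CHORD DESCENT: if the circle data is positive on `(0, θ)` and vanishes at `θ < π/2` (the foot chord
`[0, θ]` of the right foot), then `Re φ` at the chord end is below its value at the foot. -/
def TwoBodyFootChordDescent : Prop :=
  ∀ x y θ : ℝ, 0 < y → y < 1 → 0 < x → 1 < x ^ 2 + y ^ 2 → 0 < θ → θ < Real.pi / 2 →
    hM x y θ = 0 → (∀ θ' ∈ Set.Ioo 0 θ, 0 < hM x y θ') →
    (phiM x y (cexp (θ * I))).re < (phiM x y 1).re

example : TwoBodyFootChordDescent → True := fun _ => trivial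

end RhW08.Lens1Rung

end
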